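import Mathlib
import Summits.HodgeConjecture.FermatCycles.HodgeFermatThmFstarStatement

/-!
# PROPOSITION D′ at the prime levels `3p` (`p ≥ 11`, `p ≠ 13`) — the STATEMENT (count-neutral)

Cell `pub-hfermat` (tree path `Summits/HodgeConjecture/FermatCycles/`), seat prover-1 gen-4, acting on the
COORDINATOR KEEPER RULING of 2026-08-25 (gem sweep H1: take the off-gate kernel theorem `thmFstar` through the
normal gate, statement first).  The gate record of the task of record — pub-hodgefermat `CERT.md` l.978, GATE HF-G32,
«THEOREM F* of DPRIME §9 at the PRIME LEVELS 3p» — certifies TWO theorems of the sibling package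
`run/shared/lean/pub/pub-hodgefermat/lean/HodgeFermat/`: `DecodingFinal.thmFstar` (THEOREM F*(3p); through the gate
since 2026-08-25, `HodgeFermatThmFstar.lean`, seat gen-0) and PROPOSITION D′ AT THE PRIME LEVELS,
`DecodingDPrime.propDprime_prime` (module `HodgeFermat/DecodingDPrime.lean`, 66 lines; cell records
`check/DecodingDPrime_standalone.lean` sha256 `668d60b860fbbaa5…` rc 0, split pair `check/DecodingDPrime_link_standalone.lean`
`591110a937ea4979…` + `check/DecodingDPrime_part1_standalone.lean` `e147557e91070793…` rc 0), composed with THEOREM F*(3p) in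
the lake-only module `HodgeFermat/DPrimePrimeFinal.lean` (38 lines) — never put through the gate.  This file files its
STATEMENT first, as a `Prop`-valued definition and nothing else; the proof follows in `HodgeFermatDPrimePrime.lean`
(both sibling modules verbatim, on top of the landed COROLLARY M `HodgeFermatFiveThreeFinal.lean`, THEOREM F*(3p)
`HodgeFermatThmFstar.lean` and THEOREM KR6 / THEOREM U⁺ `HodgeFermatPropDPrimeNFinal.lean`), ending in
`theorem HodgeFermat.KRFree.DPrimePrimeFinal.propDprimePrime_holds : PropDPrimePrime`.

THE STATEMENT (pub-hodgefermat `tables/DPRIME-THEOREM.md` §1/§9: PROPOSITION D′(m) — two DISJOINT, JOINTLY PRIMITIVE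
zero-sum triples mod `m` with no entry `≡ 0` of the same CM type force `m ∈ {15, 21, 33, 39}` — at the prime levels
`m = 3p`).  Let `p ≥ 11`, `p ≠ 13` be prime and let `T = (a, b, c)`, `T′ = (a′, b′, c′)` be triples of natural numbers
with `a + b + c ≡ a′ + b′ + c′ ≡ 0 (mod 3p)`, no entry `≡ 0 (mod 3p)`, JOINTLY PRIMITIVE (no prime `q ∣ 3p` divides all
six entries) and DISJOINT mod `3p` (no entry of `T` congruent to an entry of `T′`).  Then `T` and `T′` do not have the
same CM type at level `3p` (`H_T ∩ (ℤ/3p)ˣ ≠ H_{T′} ∩ (ℤ/3p)ˣ`; the model `HodgeFermat.KRFree.LemmaN.SameType` filed with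
THEOREM F*'s statement, `HodgeFermatThmFstarStatement.lean`, imported here, not re-declared).  Compared with THEOREM
F*(3p) the entries need NOT be prime to `p`: COROLLARY M (clause «no prime `q ≥ 7` of `m` divides an entry») makes them
so, and THEOREM F*(3p) concludes.  This is the universal closure of the signature of the sibling's
`HodgeFermat.KRFree.DPrimePrimeFinal.propDprime_prime` (`DPrimePrimeFinal.lean:27`) with its two leading hypotheses
`(hKR : KR6') (hUplus : ThmUPlus')` — THEOREM KR6 and THEOREM U⁺, standing hypotheses of COROLLARY M in the sibling's
light modules, THEOREMS of this tree since 2026-08-26 (`HodgeFermat.KRFree.TheoremZ3U.kr6'`,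
`HodgeFermat.KRFree.PropDPrimeNFinal.thmUPlus'`, file `HodgeFermatPropDPrimeNFinal.lean`) — discharged, exactly as the
sibling's own `…Final` modules discharge them (`PropDPrimeNFinal.lean`, `DescentBFinal.lean`).  It is also the case
`N = p` of PROPOSITION D′(3N) (`HodgeFermat.KRFree.PropDPrimeNFinal.PropDPrime3N`, landed); it is filed separately because
it is the statement the HF-G32 record certifies, by the HF-G32 route (COROLLARY M + F*(3p)), not by the descent.
Context: for the Fermat variety of degree `m = 3p` the CM type of `(a, b, c)` is `H_T ∩ (ℤ/m)ˣ` (Koblitz–Rohrlich 1978);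
PROPOSITION D′ is the combinatorial input of the sibling's analysis of the Hodge gap groups `G_{3p}` (this cell's
DOOR.md §0 / RESULTS-FERMAT.md; no claim on general Hodge is made or implied here).

HONEST FRAMING: explicit algebraic cycles for specific Hodge classes on Fermat/Delsarte varieties; residual open
instances listed; no claim on general Hodge.  No `sorry`; one `Prop`-valued definition (count-neutral).
-/

set_option autoImplicit false

namespace HodgeFermat.KRFree.DPrimePrimeFinal

open HodgeFermat.KRFree.LemmaN

/-- **PROPOSITION D′ at the prime levels `3p`, `p ≥ 11`, `p ≠ 13` — the statement.**  For every prime `p ≥ 11`, `p ≠ 13`,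
and all zero-sum triples `(a, b, c)`, `(a′, b′, c′)` mod `3p` with no entry divisible by `3p`, JOINTLY PRIMITIVE (no prime
`q ∣ 3p` divides all six entries) and DISJOINT mod `3p`, the two triples do not have the same CM type at level `3p`
(`LemmaN.SameType (3p)`).  The universal closure of the signature of the sibling package's
`HodgeFermat.KRFree.DPrimePrimeFinal.propDprime_prime` (`DPrimePrimeFinal.lean:27`) after its hypotheses `KR6'`, `ThmUPlus'`
(theorems of the tree: `TheoremZ3U.kr6'`, `PropDPrimeNFinal.thmUPlus'`); proved in `HodgeFermatDPrimePrime.lean` as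
`propDprimePrime_holds`.  (pub-hodgefermat `tables/DPRIME-THEOREM.md` §9; CERT.md l.978, GATE HF-G32.) -/
def PropDPrimePrime : Prop :=
  ∀ ⦃p : ℕ⦄, p.Prime → 11 ≤ p → p ≠ 13 → ∀ ⦃a b c a' b' c' : ℕ⦄,
    3 * p ∣ a + b + c → ¬ 3 * p ∣ a → ¬ 3 * p ∣ b → ¬ 3 * p ∣ c →
    3 * p ∣ a' + b' + c' → ¬ 3 * p ∣ a' → ¬ 3 * p ∣ b' → ¬ 3 * p ∣ c' →
    (∀ q, Nat.Prime q → q ∣ 3 * p → q ∣ a → q ∣ b → q ∣ c → q ∣ a' → q ∣ b' → q ∣ c' → False) →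
    (∀ u v, (u = a ∨ u = b ∨ u = c) → (v = a' ∨ v = b' ∨ v = c') → ¬ u ≡ v [MOD 3 * p]) →
    ¬ SameType (3 * p) (a, b, c) (a', b', c')

end HodgeFermat.KRFree.DPrimePrimeFinal
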